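import Literature.Computability.Complexity.Hastad3SatDart
import Literature.Computability.Complexity.RoundInstance
import Literature.Computability.Complexity.GapAssembly
import HarnessLib

/-!
# From 3CNF to E3-CNF with completeness 1 and soundness 7/8 + δ (PCP theorem ∘ Håstad, formula level)

The tree's combinatorial PCP theorem (`Iterate.lean`/`RoundInstance.lean`: `log₂ m + 1` rounds of Dinur's
gap amplification give a `q₀`-CSP with a constant gap from a merely unsatisfiable 3CNF) composed with the
first three stages of one more round (`Round.lean`: arity reduction, degree reduction, padding +
expanderizing + laziness — Arora–Barak Claims 22.36–22.38), which hand over a regular `9/10`-spectral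
constraint graph with a constant dart gap, and then with Håstad's construction (`Hastad3SatDart.lean`:
parallel repetition of the dart game, block smoothing, the 3-query long-code test as an E3-CNF).  The
result is an explicit map on formulas (everything PROVED):

* `prep P φ` — stages 1–3 of a round on a `BCSP q₀`: `prep_sat`, `prep_spectral` (`λ ≤ 9/10`),
  `prep_gap` (gap `cgap · r` from gap `r`, an explicit constant `cgap P > 0` under `P.Good`), `prep_n_pos`;
* `hastadOfCNF δ φ` — the E3-CNF attached to a CNF `φ` of width `≤ 3` and a rational `δ > 0`
  (with the tree's explicit parameters `instP`; the number of repetitions is the least one that makes the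
  Dinur–Steurer bound `≤ 1/(4k⁴)` for the precision `k = max 8 ⌈2/δ⌉`);
* **`isExactWidth_hastadOfCNF`**, **`satisfiable_hastadOfCNF`** (`φ` satisfiable ⇒ output satisfiable),
  **`maxSatFraction_hastadOfCNF_le`** (`φ` unsatisfiable ⇒ output of value `≤ 7/8 + δ`).

This is "satisfiable E3-CNF formulas vs. `(7/8 + δ)`-satisfiable ones" (Håstad 2001, Thm 6.5) as a property
of an explicit map from 3SAT, i.e. the whole of Thm 6.5 except the polynomial running time of the map,
which is a statement about its machine rendering (cf. `Hastad3SatReduction.HastadMachine` and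
`hastad_seven_eighths_of_machines`, and the tree's `GapAssembly.GapMachine` for the PCP theorem itself).

## References

* J. Håstad, *Some optimal inapproximability results*, J. ACM 48 (2001) 798–859, Thm 6.5 [Hastad2001].
* S. Arora, B. Barak, *Computational Complexity: A Modern Approach*, CUP 2009, §22.2 (Lemma 22.4 iterated),
  Claims 22.36–22.38 [AroraBarakCC2009].
-/

noncomputable section

set_option exponentiation.threshold 4096

namespace Literature.Computability.Complexity

open Finset

namespace Expander

open BLR.Table RotGraph

namespace RoundParams

variable (P : RoundParams)

/-! ### Stages 1–3 of a round: from a `q₀`-CSP to a regular expanding constraint graph -/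

/-- **Stages 1–3 of Dinur's round** (arity reduction, degree reduction, padding/expanderizing/laziness) on a
`BCSP q₀`: the lazy regular constraint graph handed to powering — here handed to Håstad's construction.
[cite: AroraBarakCC2009, Claims 22.36–22.38] -/
def prep (φ : BCSP q₀) : LazyCSP :=
  P.padExp (EdgeCSP.degreeG P (arityW φ)) (EdgeCSP.degreeC P (arityW φ)) W

/-- The alphabet of `prep` is `W = 2^{q₀}`. [folklore] -/
theorem prep_W (φ : BCSP q₀) : (P.prep φ).W = W := rfl

/-- `prep` preserves satisfiability. [cite: AroraBarakCC2009, Claims 22.36–22.38 (completeness)] -/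
theorem prep_sat {φ : BCSP q₀} (h : φ.Sat) : (P.prep φ).Sat :=
  P.padExp_sat (EdgeCSP.degreeG P (arityW φ)) (W := W) W_pos (EdgeCSP.degree_sat P (arityW_sat h))

/-- The graph of `prep` is a `9/10`-spectral expander (lazy version). [cite: AroraBarakCC2009, Claim 22.38] -/
theorem prep_spectral (hG : P.Good) (φ : BCSP q₀) : SpectralBound (P.prep φ).G.lazy.walkMatrix (9 / 10) :=
  P.padExp_spectral hG _ _ _

/-- The number of vertices of `prep φ` is positive when `φ` has a constraint. [folklore] -/
theorem prep_n_pos {φ : BCSP q₀} (hm : 0 < φ.cons.length) : 0 < (P.prep φ).n := by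
  show 0 < P.Nx ((arityW φ).m * 2)
  have : 0 < (arityW φ).m * 2 := by
    show 0 < φ.cons.length * q₀ * 2
    have := q₀_pos; positivity
  exact lt_of_lt_of_le this (P.Nx_ge _)

/-- `dH > 0`. [folklore] -/
theorem prep_dH_pos (φ : BCSP q₀) : 0 < (P.prep φ).dH + (P.prep φ).dH := by
  show 0 < P.dH + P.dH; have := P.dH_pos; positivity

/-- The gap constant of stages 1–3: `min(2, η) / (q₀ · 2d₁ · cN · 2(1 + dX))`. [cite: AroraBarakCC2009, Claims 22.36–22.38] -/
def cgap : ℝ := min 2 P.η / ((q₀ : ℝ) * (2 * P.d₁) * P.cN * (2 * (1 + P.dX)))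

/-- `cgap > 0` under `P.Good`. [folklore] -/
theorem cgap_pos (hG : P.Good) : 0 < P.cgap := by
  unfold cgap
  have hqR : (0 : ℝ) < q₀ := by exact_mod_cast q₀_pos
  have hd1 : (0 : ℝ) < P.d₁ := by exact_mod_cast (show 0 < P.d₁ from Nat.succ_pos _)
  exact div_pos (lt_min two_pos hG.η_pos) (mul_pos (mul_pos (mul_pos hqR (mul_pos two_pos hd1)) hG.cN_pos) (by positivity))

/-- **Soundness of stages 1–3**: a gap `r ≥ 0` of `φ` (with a constraint) gives a dart gap `cgap · r` of the
lazy constraint graph. [cite: AroraBarakCC2009, Claims 22.36–22.38 (soundness)] -/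
theorem prep_gap (hG : P.Good) {φ : BCSP q₀} (hm : 0 < φ.cons.length) {r : ℝ} (hr0 : 0 ≤ r) (h : φ.Gap r) :
    (P.prep φ).Gap (P.cgap * r) := by
  have hq : 0 < q₀ := q₀_pos
  have hqR : (0 : ℝ) < q₀ := by exact_mod_cast hq
  have hWpos : 0 < W := W_pos
  set ψ₁ := arityW φ with hψ₁
  have hψ₁m : ψ₁.m = φ.cons.length * q₀ := rfl
  have hn₂ : 0 < ψ₁.m * 2 := by rw [hψ₁m]; positivity
  set n₂ := ψ₁.m * 2 with hn₂def
  set G₂ := EdgeCSP.degreeG P ψ₁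
  set C₂ := EdgeCSP.degreeC P ψ₁
  have hNpos : 0 < P.Nx n₂ := lt_of_lt_of_le hn₂ (P.Nx_ge n₂)
  have g1 : ψ₁.Gap (r / q₀) := arityW_gap h
  have g2 : ∀ y : Fin n₂ → ℕ, (∀ v, y v < W) →
      min 2 P.η * (r / q₀ * ψ₁.m) ≤ ((univ.filter fun x : Fin n₂ × Fin P.d₁ =>
        C₂ x.1 x.2 (y x.1) (y (G₂.nbr x.1 x.2)) = false).card : ℝ) :=
    fun y hy => EdgeCSP.degree_gap P hG hWpos g1 y hy
  have g3 : (P.prep φ).Gap (min 2 P.η * (r / q₀ * ψ₁.m) / (P.Nx n₂ * P.D)) := P.padExp_gap G₂ C₂ W g2 hNpos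
  -- `cgap · r ≤ ε₃`
  have hmin0 : 0 ≤ min 2 P.η := le_min zero_le_two hG.η_pos.le
  have hDpos : (0 : ℝ) < P.D := by exact_mod_cast P.D_pos
  have hNR : (0 : ℝ) < P.Nx n₂ := by exact_mod_cast hNpos
  have hNx := hG.Nx_le n₂ hn₂
  have hd1 : (0 : ℝ) < P.d₁ := by exact_mod_cast (show 0 < P.d₁ from Nat.succ_pos _)
  have hK : (0 : ℝ) < (q₀ : ℝ) * (2 * P.d₁) * P.cN * (2 * (1 + P.dX)) :=
    mul_pos (mul_pos (mul_pos hqR (mul_pos two_pos hd1)) hG.cN_pos) (by positivity)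
  have hmr : 0 ≤ min 2 P.η * r := mul_nonneg hmin0 hr0
  have hND : (0 : ℝ) < P.Nx n₂ * P.D := mul_pos hNR hDpos
  have hDeq : ((P.D : ℕ) : ℝ) = 2 * ((P.d₁ : ℕ) : ℝ) * (1 + P.dX) := by
    rw [show P.D = 2 * P.d₁ * (1 + P.dX) from by unfold RoundParams.D RoundParams.dH; ring]
    push_cast; ring
  have hn₂R : (n₂ : ℝ) = φ.cons.length * q₀ * 2 := by rw [hn₂def, hψ₁m]; push_cast; ring
  have hε₃c : P.cgap * r ≤ min 2 P.η * (r / q₀ * ψ₁.m) / (P.Nx n₂ * P.D) := by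
    unfold cgap
    rw [hψ₁m, div_mul_eq_mul_div, div_le_div_iff₀ hK hND]
    push_cast
    rw [show r / (q₀ : ℝ) * (φ.cons.length * q₀) = r * φ.cons.length by field_simp]
    have key : (P.Nx n₂ : ℝ) * P.D ≤ φ.cons.length * ((q₀ : ℝ) * (2 * P.d₁) * P.cN * (2 * (1 + P.dX))) :=
      calc (P.Nx n₂ : ℝ) * P.D ≤ P.cN * n₂ * P.D := mul_le_mul_of_nonneg_right hNx hDpos.le
        _ = _ := by rw [hn₂R, hDeq]; ring
    calc min 2 P.η * r * (P.Nx n₂ * P.D)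
        ≤ min 2 P.η * r * (φ.cons.length * ((q₀ : ℝ) * (2 * P.d₁) * P.cN * (2 * (1 + P.dX)))) :=
          mul_le_mul_of_nonneg_left key hmr
      _ = min 2 P.η * (r * φ.cons.length) * (q₀ * (2 * P.d₁) * P.cN * (2 * (1 + P.dX))) := by ring
  -- gaps are antitone
  intro σ hσ
  exact le_trans (mul_le_mul_of_nonneg_right hε₃c (by positivity)) (g3 σ hσ)

/-- In a satisfiable lazy instance every dart has an accepting pair of values `< W`. [folklore] -/
theorem exists_acc_of_sat {ψ : LazyCSP} (h : ψ.Sat) (v : Fin ψ.n) (i : Fin (ψ.dH + ψ.dH)) :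
    ∃ p : ℕ × ℕ, p.1 < ψ.W ∧ p.2 < ψ.W ∧ ψ.C v i p.1 p.2 = true := by
  obtain ⟨σ, hσ, hsat⟩ := h
  exact ⟨(σ v, σ (ψ.G.lazy.nbr v i)), hσ _, hσ _, hsat v i⟩

end RoundParams

/-! ### The map on formulas -/

namespace LazyCSP

open ProjGame RoundParams

open Classical in
/-- **Håstad's E3-CNF of a lazy regular constraint graph** at precision `k` with `T'` repetitions, when
every dart has an accepting pair (else the fixed no-instance). [cite: Hastad2001, Thm 6.5] -/
def hastadCNFOf (ψ : LazyCSP) (k T' : ℕ) (hk : 0 < k) (hT' : 0 < T') : CNF ℕ :=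
  if h : (∀ v i, ∃ p : ℕ × ℕ, p.1 < ψ.W ∧ p.2 < ψ.W ∧ ψ.C v i p.1 p.2 = true) ∧ 0 < ψ.n ∧ 0 < ψ.dH + ψ.dH then
    ((ψ.G.lazy.dartGame2 ψ.C ψ.W h.2.2).pow T').hastadCNF k
      (ψ.G.lazy.dartHyp ψ.C ψ.W h.2.2 (fun v i => Classical.choose (h.1 v i))
        (fun v i => Classical.choose_spec (h.1 v i)) h.2.1 T' hT') hk
  else noE3

/-- The output is an E3-CNF. [cite: Hastad2001, Thm 6.5] -/
theorem isExactWidth_hastadCNFOf (ψ : LazyCSP) (k T' : ℕ) (hk : 0 < k) (hT' : 0 < T') :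
    (ψ.hastadCNFOf k T' hk hT').IsExactWidth 3 := by
  unfold hastadCNFOf
  split_ifs with h
  · exact hastad_dart_isExactWidth _ _ _ _ _ _ _ _ _ _ hk
  · exact isExactWidth_noE3

/-- **Completeness**: a satisfiable lazy instance (with a vertex) gives a satisfiable E3-CNF.
[cite: Hastad2001, Thm 6.5 (completeness)] -/
theorem satisfiable_hastadCNFOf {ψ : LazyCSP} (h : ψ.Sat) (hn : 0 < ψ.n) (hd : 0 < ψ.dH + ψ.dH) (k T' : ℕ)
    (hk : 0 < k) (hT' : 0 < T') : (ψ.hastadCNFOf k T' hk hT').Satisfiable := by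
  have hcond : (∀ v i, ∃ p : ℕ × ℕ, p.1 < ψ.W ∧ p.2 < ψ.W ∧ ψ.C v i p.1 p.2 = true) ∧ 0 < ψ.n ∧ 0 < ψ.dH + ψ.dH :=
    ⟨RoundParams.exists_acc_of_sat h, hn, hd⟩
  unfold hastadCNFOf
  rw [dif_pos hcond]
  obtain ⟨σ, hσ, hsat⟩ := h
  exact hastad_dart_satisfiable _ _ _ _ _ _ _ _ _ _ hk hσ hsat

/-- **Soundness**: a dart gap `ε ∈ (0, 2]`, `λ ≤ λ₀ < 1`, `k ≥ 8` and enough repetitions give value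
`≤ 7/8 + 2/k`. [cite: Hastad2001, Thm 6.5 (soundness)] -/
theorem maxSatFraction_hastadCNFOf_le {ψ : LazyCSP} {k T' : ℕ} (hk : 8 ≤ k) (hT' : 0 < T') {lam ε : ℝ}
    (hlam : SpectralBound ψ.G.lazy.walkMatrix lam) (hlam1 : lam < 1) (hε2 : ε ≤ 2) (hgap : ψ.Gap ε)
    (hT'k : Real.sqrt (1 - ProjGame.dsEps ((1 - lam) / 2) (ε / 2)) ^ T' ≤ 1 / (4 * (k : ℝ) ^ 4)) :
    ((ψ.hastadCNFOf k T' (by omega) hT').maxSatFraction : ℝ) ≤ 7 / 8 + 2 / k := by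
  unfold hastadCNFOf
  split_ifs with h
  · refine hastad_dart_maxSatFraction_le _ _ _ _ _ _ _ _ _ _ hk hlam hlam1 hε2 (fun σ hσ => ?_) hT'k
    have := hgap σ hσ
    unfold LazyCSP.viol at this
    push_cast at this ⊢
    exact this
  · have h78 := maxSatFraction_noE3_le
    have h78R : ((noE3.maxSatFraction : ℚ) : ℝ) ≤ ((7 / 8 : ℚ) : ℝ) := by exact_mod_cast h78
    have hk0 : (0 : ℝ) ≤ 2 / k := by positivity
    push_cast at h78R
    linarith

end LazyCSP

namespace RoundParams

open ProjGame

/-- The number of repetitions at precision `k`: the least `T' ≥ 1` making the Dinur–Steurer bound for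
`λ = 9/10` and dart gap `min(cgap · ε₀, 2)` at most `1/(4k⁴)`. [cite: DinurSteurer2014, §3.3] -/
def reps (k : ℕ) (hk : 0 < k) : ℕ :=
  Nat.find (RotGraph.exists_repetitions k hk (show (9 / 10 : ℝ) < 1 by norm_num)
    (lt_min (mul_pos (instP.cgap_pos instP_good) instP.ε₀_pos) two_pos) :
      ∃ T' : ℕ, 0 < T' ∧ Real.sqrt (1 - ProjGame.dsEps ((1 - 9 / 10) / 2) (min (instP.cgap * instP.ε₀) 2 / 2)) ^ T' ≤
        1 / (4 * (k : ℝ) ^ 4))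

/-- The defining property of `reps`. [folklore] -/
theorem reps_spec (k : ℕ) (hk : 0 < k) :
    0 < reps k hk ∧ Real.sqrt (1 - ProjGame.dsEps ((1 - 9 / 10) / 2) (min (instP.cgap * instP.ε₀) 2 / 2)) ^ reps k hk ≤
      1 / (4 * (k : ℝ) ^ 4) :=
  Nat.find_spec (RotGraph.exists_repetitions k hk (show (9 / 10 : ℝ) < 1 by norm_num)
    (lt_min (mul_pos (instP.cgap_pos instP_good) instP.ε₀_pos) two_pos))

/-- The precision at tolerance `δ`: `k = max 8 ⌈2/δ⌉`. [folklore] -/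
def prec (δ : ℚ) : ℕ := max 8 ⌈2 / δ⌉₊

/-- `8 ≤ prec δ` and `2 / prec δ ≤ δ` for `δ > 0`. [folklore] -/
theorem prec_spec {δ : ℚ} (hδ : 0 < δ) : 8 ≤ prec δ ∧ (2 : ℚ) / prec δ ≤ δ := by
  refine ⟨le_max_left _ _, ?_⟩
  unfold prec
  have h1 : (2 : ℚ) / δ ≤ ⌈2 / δ⌉₊ := Nat.le_ceil _
  have h2 : (⌈2 / δ⌉₊ : ℚ) ≤ ((max 8 ⌈2 / δ⌉₊ : ℕ) : ℚ) := by exact_mod_cast le_max_right _ _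
  have hpos : (0 : ℚ) < ((max 8 ⌈2 / δ⌉₊ : ℕ) : ℚ) := by
    have : (8 : ℕ) ≤ max 8 ⌈2 / δ⌉₊ := le_max_left _ _
    exact_mod_cast Nat.lt_of_lt_of_le (by norm_num) this
  rw [div_le_iff₀ hpos]
  have h3 : (2 : ℚ) / δ * δ = 2 := div_mul_cancel₀ _ hδ.ne'
  nlinarith

/-- A fixed satisfiable E3-CNF (for the empty input). [folklore] -/
def yesE3 : CNF ℕ := [[(0, true), (1, true), (2, true)]]

/-- `yesE3` is an E3-CNF. [folklore] -/
theorem isExactWidth_yesE3 : yesE3.IsExactWidth 3 := by decide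

/-- `yesE3` is satisfiable. [folklore] -/
theorem satisfiable_yesE3 : yesE3.Satisfiable := ⟨fun _ => true, by decide⟩

/-- **The map on formulas** (PCP theorem ∘ Håstad, with the tree's explicit parameters `instP`): a CNF
`φ` of width `≤ 3` and a tolerance `δ > 0` are sent to `yesE3` if `φ` is empty, and otherwise to Håstad's
E3-CNF of the lazy regular constraint graph obtained from `log₂ m + 1` rounds of gap amplification followed
by stages 1–3 of one more round, at precision `prec δ` with `reps` repetitions.
[cite: Hastad2001, Thm 6.5] -/
def hastadOfCNF (δ : ℚ) (hδ : 0 < δ) (φ : CNF ℕ) : CNF ℕ :=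
  if φ.length = 0 then yesE3 else
    (instP.prep (instP.iterate (Nat.log 2 φ.length + 1) (BCSP.ofCNF q₀ φ))).hastadCNFOf (prec δ)
      (reps (prec δ) (by have := (prec_spec hδ).1; omega)) (by have := (prec_spec hδ).1; omega)
      (reps_spec (prec δ) (by have := (prec_spec hδ).1; omega)).1

/-- **The output is an E3-CNF.** [cite: Hastad2001, Thm 6.5] -/
theorem isExactWidth_hastadOfCNF {δ : ℚ} (hδ : 0 < δ) (φ : CNF ℕ) :
    (hastadOfCNF δ hδ φ).IsExactWidth 3 := by
  unfold hastadOfCNF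
  split_ifs
  · exact isExactWidth_yesE3
  · exact LazyCSP.isExactWidth_hastadCNFOf _ _ _ _ _

/-- **Completeness** (Håstad 2001, Thm 6.5: satisfiable formulas): a satisfiable CNF of width `≤ 3` is sent to
a satisfiable E3-CNF. [cite: Hastad2001, Thm 6.5] -/
theorem satisfiable_hastadOfCNF {δ : ℚ} (hδ : 0 < δ) {φ : CNF ℕ} (hw : φ.IsWidthLE 3)
    (h : φ.Satisfiable) : (hastadOfCNF δ hδ φ).Satisfiable := by
  unfold hastadOfCNF
  split_ifs with hm
  · exact satisfiable_yesE3
  · have hm0 : 0 < φ.length := Nat.pos_of_ne_zero hm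
    have h3 : φ.IsWidthLE q₀ := hw.mono (by rw [q₀_eq]; norm_num)
    have hB := instP.iterate_sat (BCSP.ofCNF_sat q₀ h3 h) (Nat.log 2 φ.length + 1)
    have hlen := instP.iterate_length_pos (φ := BCSP.ofCNF q₀ φ) (by rw [BCSP.ofCNF_length]; exact hm0)
      (Nat.log 2 φ.length + 1)
    exact LazyCSP.satisfiable_hastadCNFOf (instP.prep_sat hB) (instP.prep_n_pos hlen) (instP.prep_dH_pos _) _ _ _ _

/-- **Soundness** (Håstad 2001, Thm 6.5: `(7/8 + δ)`-satisfiable formulas): an unsatisfiable CNF of width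
`≤ 3` is sent to an E3-CNF of value at most `7/8 + δ`. [cite: Hastad2001, Thm 6.5] -/
theorem maxSatFraction_hastadOfCNF_le {δ : ℚ} (hδ : 0 < δ) {φ : CNF ℕ} (hw : φ.IsWidthLE 3)
    (h : ¬ φ.Satisfiable) : ((hastadOfCNF δ hδ φ).maxSatFraction : ℝ) ≤ 7 / 8 + δ := by
  have hm : 0 < φ.length := by
    rcases Nat.eq_zero_or_pos φ.length with h0 | h0
    · exact absurd ⟨fun _ => false, by rw [List.length_eq_zero_iff.1 h0]; rfl⟩ h
    · exact h0
  unfold hastadOfCNF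
  rw [if_neg hm.ne']
  -- the gap after `log₂ m + 1` rounds is `ε₀`
  have h3 : φ.IsWidthLE q₀ := hw.mono (by rw [q₀_eq]; norm_num)
  have hgap0 := BCSP.ofCNF_gap q₀ h3 h
  set N := Nat.log 2 φ.length + 1 with hN
  have hgap := instP.iterate_gap instP_good (by positivity) hgap0 N
  have h2k : (φ.length : ℝ) ≤ 2 ^ N := by exact_mod_cast (Nat.lt_pow_succ_log_self one_lt_two φ.length).le
  have hmin : min (2 ^ N * (1 / (φ.length : ℝ))) instP.ε₀ = instP.ε₀ := by
    refine min_eq_right (instP.ε₀_le_one.trans ?_)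
    have hmR : (0 : ℝ) < φ.length := by exact_mod_cast hm
    rw [mul_one_div, le_div_iff₀ hmR, one_mul]
    exact h2k
  rw [hmin] at hgap
  have hlen := instP.iterate_length_pos (φ := BCSP.ofCNF q₀ φ) (by rw [BCSP.ofCNF_length]; exact hm) N
  -- stages 1–3: dart gap `cgap · ε₀`, hence `min (cgap ε₀) 2`
  have hg3 := instP.prep_gap instP_good hlen instP.ε₀_nonneg hgap
  set ψ := instP.prep (instP.iterate N (BCSP.ofCNF q₀ φ)) with hψ
  have hg3' : ψ.Gap (min (instP.cgap * instP.ε₀) 2) := fun σ hσ =>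
    le_trans (mul_le_mul_of_nonneg_right (min_le_left _ _) (by positivity)) (hg3 σ hσ)
  obtain ⟨hk8, hkδ⟩ := prec_spec hδ
  have hrs := reps_spec (prec δ) (by omega)
  have hmain := LazyCSP.maxSatFraction_hastadCNFOf_le (ψ := ψ) hk8 hrs.1 (instP.prep_spectral instP_good _)
    (by norm_num) (min_le_right _ _) hg3' hrs.2
  refine hmain.trans ?_
  have : ((2 / prec δ : ℚ) : ℝ) ≤ δ := by exact_mod_cast hkδ
  push_cast at this
  linarith

end RoundParams

end Expander

end Literature.Computability.Complexity

end
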